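import Mathlib
import Summits.ValiantsHypothesis.ValiantsHypothesis.Theorems.NewtonUnitEquationsDissociatedUniformGreedyCharts
import Summits.ValiantsHypothesis.ValiantsHypothesis.Theorems.NewtonUnitEquationsDissociatedUniformChartSweep

/-!
# Theorem Q glue, II: the product step

For a product configuration `E₁ ×ˢ E₂` (Hadamard-product vectors `x₁ e₁ * x₂ e₂`, added coordinates) the configuration
shadow is quasi-multiplicatively controlled by the factor shadows:
`|cshadow (E₁ × E₂)| ≤ 2·k²·(k·s₁ + k·s₂ + 1) + 2k + 1`, `sᵢ = |cshadow Eᵢ|` (`ncard_cshadow_prod_le`).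
Along a chart, a greedy pair has greedy components (part Q1 `lexGreedy_prod_split`), the factor greedy sets change
monotonically with the rank potential (part Q3 `lexGreedy_chart_monotone`), so only `≤ k s₁ + k s₂ + 1` distinct pairs of
factor greedy sets occur (`ncard_chartShadow_prod_le`); then the chart decomposition of part I.
Line `greedy-basis-shadow` of crux stmt-ValiantsHypothesis-5905. [folklore]
-/

set_option linter.dupNamespace false

namespace Summit.ValiantsHypothesis.ValiantsHypothesis.Theorems.NewtonUnitEquationsDissociatedUniform

open scoped BigOperators

namespace QuasiPoly

noncomputable section

variable {α β : Type} {k : ℕ}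

/-- The rank potential of part Q3 (in `gE` form). -/
def rpot (E U : Finset α) (x : α → Fin k → ℂ) (u v : α → ℝ) (lam : ℝ) : ℕ :=
  ∑ e ∈ U, Set.ncard {e' : α | e' ∈ U ∧ e ∈ gE E x (fun e => u e + lam * v e) ∧ v e' < v e}

/-- Part Q3 in `gE`/`rpot` form: the rank potential is monotone along a chart and separates greedy sets. -/
theorem rpot_mono (E U : Finset α) (x : α → Fin k → ℂ) (u v : α → ℝ) (hUE : U ⊆ E)
    (hU : ∀ lam : ℝ, Set.InjOn (fun e => u e + lam * v e) E → gE E x (fun e => u e + lam * v e) ⊆ U)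
    {lam₁ lam₂ : ℝ} (hle : lam₁ ≤ lam₂) (h₁ : Set.InjOn (fun e => u e + lam₁ * v e) E)
    (h₂ : Set.InjOn (fun e => u e + lam₂ * v e) E) :
    rpot E U x u v lam₁ ≤ rpot E U x u v lam₂ ∧
      (rpot E U x u v lam₁ = rpot E U x u v lam₂ →
        gE E x (fun e => u e + lam₁ * v e) = gE E x (fun e => u e + lam₂ * v e)) :=
  lexGreedy_chart_monotone α k E U x u v hUE hU lam₁ lam₂ hle h₁ h₂

/-- The rank potential is at most `k · |U|`. -/
theorem rpot_le (E U : Finset α) (x : α → Fin k → ℂ) (u v : α → ℝ) {lam : ℝ}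
    (hinj : Set.InjOn (fun e => u e + lam * v e) E) : rpot E U x u v lam ≤ k * U.card := by
  classical
  unfold rpot
  set G := gE E x (fun e => u e + lam * v e) with hG
  have hterm : ∀ e ∈ U, Set.ncard {e' : α | e' ∈ U ∧ e ∈ G ∧ v e' < v e} ≤ if e ∈ G then U.card else 0 := by
    intro e _
    by_cases he : e ∈ G
    · rw [if_pos he]
      calc Set.ncard {e' : α | e' ∈ U ∧ e ∈ G ∧ v e' < v e} ≤ (U : Set α).ncard :=
            Set.ncard_le_ncard (fun e' he' => he'.1) U.finite_toSet
        _ = U.card := Set.ncard_coe_finset U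
    · rw [if_neg he]
      have : {e' : α | e' ∈ U ∧ e ∈ G ∧ v e' < v e} = ∅ := by
        ext e'; simp [he]
      rw [this, Set.ncard_empty]
  calc ∑ e ∈ U, Set.ncard {e' : α | e' ∈ U ∧ e ∈ G ∧ v e' < v e}
      ≤ ∑ e ∈ U, (if e ∈ G then U.card else 0) := Finset.sum_le_sum hterm
    _ = (U.filter fun e => e ∈ G).card * U.card := by
        rw [Finset.sum_ite, Finset.sum_const_zero, add_zero, Finset.sum_const, smul_eq_mul]
    _ ≤ k * U.card := by
        refine Nat.mul_le_mul_right _ ?_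
        calc (U.filter fun e => e ∈ G).card = ((U.filter fun e => e ∈ G : Finset α) : Set α).ncard :=
              (Set.ncard_coe_finset _).symm
          _ ≤ G.ncard := Set.ncard_le_ncard (fun e he => (Finset.mem_filter.mp he).2) (gE_finite E x _)
          _ ≤ k := ncard_gE_le E x _ hinj

section Product

variable (E₁ : Finset α) (E₂ : Finset β) (x₁ : α → Fin k → ℂ) (x₂ : β → Fin k → ℂ)
  (u₁ v₁ : α → ℝ) (u₂ v₂ : β → ℝ)

/-- Injectivity of a product chart height passes to the first factor. -/
theorem injOn_fst {lam : ℝ} (hinj : Set.InjOn (fun p : α × β => (u₁ p.1 + u₂ p.2) + lam * (v₁ p.1 + v₂ p.2))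
      ((E₁ ×ˢ E₂ : Finset (α × β)) : Set (α × β)))
    {b : β} (hb : b ∈ E₂) : Set.InjOn (fun e => u₁ e + lam * v₁ e) E₁ := by
  intro a ha a' ha' h
  have h' : u₁ a + lam * v₁ a = u₁ a' + lam * v₁ a' := h
  have hmem : (a, b) ∈ (E₁ ×ˢ E₂ : Finset (α × β)) := Finset.mem_product.mpr ⟨ha, hb⟩
  have hmem' : (a', b) ∈ (E₁ ×ˢ E₂ : Finset (α × β)) := Finset.mem_product.mpr ⟨ha', hb⟩
  have heq : (u₁ a + u₂ b) + lam * (v₁ a + v₂ b) = (u₁ a' + u₂ b) + lam * (v₁ a' + v₂ b) := by linarith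
  have := hinj (Finset.mem_coe.mpr hmem) (Finset.mem_coe.mpr hmem') heq
  exact (Prod.mk.inj this).1

/-- Injectivity of a product chart height passes to the second factor. -/
theorem injOn_snd {lam : ℝ} (hinj : Set.InjOn (fun p : α × β => (u₁ p.1 + u₂ p.2) + lam * (v₁ p.1 + v₂ p.2))
      ((E₁ ×ˢ E₂ : Finset (α × β)) : Set (α × β)))
    {a : α} (ha : a ∈ E₁) : Set.InjOn (fun e => u₂ e + lam * v₂ e) E₂ := by
  intro b hb b' hb' h
  have h' : u₂ b + lam * v₂ b = u₂ b' + lam * v₂ b' := h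
  have hmem : (a, b) ∈ (E₁ ×ˢ E₂ : Finset (α × β)) := Finset.mem_product.mpr ⟨ha, hb⟩
  have hmem' : (a, b') ∈ (E₁ ×ˢ E₂ : Finset (α × β)) := Finset.mem_product.mpr ⟨ha, hb'⟩
  have heq : (u₁ a + u₂ b) + lam * (v₁ a + v₂ b) = (u₁ a + u₂ b') + lam * (v₁ a + v₂ b') := by linarith
  have := hinj (Finset.mem_coe.mpr hmem) (Finset.mem_coe.mpr hmem') heq
  exact (Prod.mk.inj this).2

/-- Part Q1 along a chart: a greedy pair has greedy components. -/
theorem gE_prod_subset (lam : ℝ) :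
    gE (E₁ ×ˢ E₂) (fun p : α × β => x₁ p.1 * x₂ p.2) (fun p : α × β => (u₁ p.1 + u₂ p.2) + lam * (v₁ p.1 + v₂ p.2)) ⊆
      gE E₁ x₁ (fun e => u₁ e + lam * v₁ e) ×ˢ gE E₂ x₂ (fun e => u₂ e + lam * v₂ e) := by
  intro p hp
  have hfun : (fun p : α × β => (u₁ p.1 + u₂ p.2) + lam * (v₁ p.1 + v₂ p.2)) =
      fun p : α × β => (fun e => u₁ e + lam * v₁ e) p.1 + (fun e => u₂ e + lam * v₂ e) p.2 := by
    funext p; ring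
  rw [hfun] at hp
  have h := lexGreedy_prod_split α β k E₁ E₂ x₁ x₂ (fun e => u₁ e + lam * v₁ e) (fun e => u₂ e + lam * v₂ e) p.1 p.2 hp
  exact Set.mem_prod.mpr h

/-- **The product chart bound.**  Along a chart, the greedy pairs of the product configuration are covered by
`≤ k|U₁| + k|U₂| + 1` products of factor greedy sets, each of size `≤ k²`. -/
theorem ncard_chartShadow_prod_le :
    (chartShadow (E₁ ×ˢ E₂) (fun p : α × β => x₁ p.1 * x₂ p.2) (fun p : α × β => u₁ p.1 + u₂ p.2)
        (fun p : α × β => v₁ p.1 + v₂ p.2)).ncard ≤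
      k * k * (k * (chartShadow E₁ x₁ u₁ v₁).ncard + k * (chartShadow E₂ x₂ u₂ v₂).ncard + 1) := by
  classical
  -- the factor chart shadows as finsets `U₁, U₂`
  set U₁ : Finset α := (chartShadow_finite E₁ x₁ u₁ v₁).toFinset with hU₁
  set U₂ : Finset β := (chartShadow_finite E₂ x₂ u₂ v₂).toFinset with hU₂
  have hU₁E : U₁ ⊆ E₁ := fun e he => chartShadow_subset E₁ x₁ u₁ v₁ ((Set.Finite.mem_toFinset _).mp he)
  have hU₂E : U₂ ⊆ E₂ := fun e he => chartShadow_subset E₂ x₂ u₂ v₂ ((Set.Finite.mem_toFinset _).mp he)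
  have hU₁card : U₁.card = (chartShadow E₁ x₁ u₁ v₁).ncard := (Set.ncard_eq_toFinset_card _ _).symm
  have hU₂card : U₂.card = (chartShadow E₂ x₂ u₂ v₂).ncard := (Set.ncard_eq_toFinset_card _ _).symm
  have hGU₁ : ∀ lam : ℝ, Set.InjOn (fun e => u₁ e + lam * v₁ e) E₁ → gE E₁ x₁ (fun e => u₁ e + lam * v₁ e) ⊆ U₁ :=
    fun lam hinj e he => (Set.Finite.mem_toFinset _).mpr ⟨lam, hinj, he⟩
  have hGU₂ : ∀ lam : ℝ, Set.InjOn (fun e => u₂ e + lam * v₂ e) E₂ → gE E₂ x₂ (fun e => u₂ e + lam * v₂ e) ⊆ U₂ :=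
    fun lam hinj e he => (Set.Finite.mem_toFinset _).mpr ⟨lam, hinj, he⟩
  -- notation
  set G₁ : ℝ → Set α := fun lam => gE E₁ x₁ (fun e => u₁ e + lam * v₁ e) with hG₁
  set G₂ : ℝ → Set β := fun lam => gE E₂ x₂ (fun e => u₂ e + lam * v₂ e) with hG₂
  set Λ : Set ℝ := {lam | Set.InjOn (fun e => u₁ e + lam * v₁ e) E₁ ∧ Set.InjOn (fun e => u₂ e + lam * v₂ e) E₂} with hΛ
  set Φ : ℝ → ℕ := fun lam => rpot E₁ U₁ x₁ u₁ v₁ lam + rpot E₂ U₂ x₂ u₂ v₂ lam with hΦ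
  set K : ℕ := k * U₁.card + k * U₂.card with hK
  have hΦle : ∀ lam ∈ Λ, Φ lam ≤ K := fun lam hlam =>
    add_le_add (rpot_le E₁ U₁ x₁ u₁ v₁ hlam.1) (rpot_le E₂ U₂ x₂ u₂ v₂ hlam.2)
  -- the key: equal potentials force equal greedy pairs
  have hkey : ∀ lam ∈ Λ, ∀ mu ∈ Λ, Φ lam = Φ mu → G₁ lam = G₁ mu ∧ G₂ lam = G₂ mu := by
    suffices H : ∀ lam ∈ Λ, ∀ mu ∈ Λ, lam ≤ mu → Φ lam = Φ mu → G₁ lam = G₁ mu ∧ G₂ lam = G₂ mu by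
      intro lam hlam mu hmu h
      rcases le_total lam mu with hle | hle
      · exact H lam hlam mu hmu hle h
      · obtain ⟨h1, h2⟩ := H mu hmu lam hlam hle h.symm
        exact ⟨h1.symm, h2.symm⟩
    intro lam hlam mu hmu hle h
    have m₁ := rpot_mono E₁ U₁ x₁ u₁ v₁ hU₁E hGU₁ hle hlam.1 hmu.1
    have m₂ := rpot_mono E₂ U₂ x₂ u₂ v₂ hU₂E hGU₂ hle hlam.2 hmu.2
    have e₁ : rpot E₁ U₁ x₁ u₁ v₁ lam = rpot E₁ U₁ x₁ u₁ v₁ mu := by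
      have := m₁.1; have := m₂.1; simp only [hΦ] at h; omega
    have e₂ : rpot E₂ U₂ x₂ u₂ v₂ lam = rpot E₂ U₂ x₂ u₂ v₂ mu := by
      have := m₁.1; have := m₂.1; simp only [hΦ] at h; omega
    exact ⟨m₁.2 e₁, m₂.2 e₂⟩
  -- boxes indexed by potential values
  set B : ℕ → Set (α × β) := fun n =>
    if h : ∃ lam ∈ Λ, Φ lam = n then G₁ h.choose ×ˢ G₂ h.choose else ∅ with hB
  have hBle : ∀ n, (B n).ncard ≤ k * k := by
    intro n
    simp only [hB]
    split_ifs with h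
    · obtain ⟨hlamΛ, -⟩ := h.choose_spec
      rw [Set.ncard_prod]
      exact Nat.mul_le_mul (ncard_gE_le E₁ x₁ _ hlamΛ.1) (ncard_gE_le E₂ x₂ _ hlamΛ.2)
    · rw [Set.ncard_empty]; exact Nat.zero_le _
  have hBfin : ∀ n, (B n).Finite := by
    intro n
    simp only [hB]
    split_ifs with h
    · exact (gE_finite E₁ x₁ _).prod (gE_finite E₂ x₂ _)
    · exact Set.finite_empty
  -- the chart shadow of the product is covered by the boxes `B n`, `n ≤ K`
  have hcover : chartShadow (E₁ ×ˢ E₂) (fun p : α × β => x₁ p.1 * x₂ p.2) (fun p : α × β => u₁ p.1 + u₂ p.2)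
      (fun p : α × β => v₁ p.1 + v₂ p.2) ⊆ ⋃ n ∈ Finset.range (K + 1), B n := by
    rintro p ⟨lam, hinj, hp⟩
    have hpE : p ∈ (E₁ ×ˢ E₂ : Finset (α × β)) := hp.1
    obtain ⟨hp1, hp2⟩ := Finset.mem_product.mp hpE
    have hinj' : Set.InjOn (fun p : α × β => (u₁ p.1 + u₂ p.2) + lam * (v₁ p.1 + v₂ p.2))
        ((E₁ ×ˢ E₂ : Finset (α × β)) : Set (α × β)) := hinj
    have hlamΛ : lam ∈ Λ := ⟨injOn_fst E₁ E₂ u₁ v₁ u₂ v₂ hinj' hp2, injOn_snd E₁ E₂ u₁ v₁ u₂ v₂ hinj' hp1⟩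
    have hpG := gE_prod_subset E₁ E₂ x₁ x₂ u₁ v₁ u₂ v₂ lam hp
    have hex : ∃ lam' ∈ Λ, Φ lam' = Φ lam := ⟨lam, hlamΛ, rfl⟩
    refine Set.mem_iUnion₂.mpr ⟨Φ lam, Finset.mem_range.mpr (Nat.lt_succ_of_le (hΦle lam hlamΛ)), ?_⟩
    simp only [hB, dif_pos hex]
    obtain ⟨hcΛ, hcΦ⟩ := hex.choose_spec
    obtain ⟨h1, h2⟩ := hkey _ hcΛ lam hlamΛ hcΦ
    rw [h1, h2]
    exact hpG
  -- count
  have hUfin : (⋃ n ∈ Finset.range (K + 1), B n).Finite :=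
    Set.Finite.biUnion (Finset.finite_toSet _) fun n _ => hBfin n
  have hUnion : ∀ s : Finset ℕ, (⋃ n ∈ s, B n).ncard ≤ s.card * (k * k) := by
    intro s
    induction s using Finset.induction_on with
    | empty => simp
    | insert a s ha ih =>
      rw [Finset.set_biUnion_insert, Finset.card_insert_of_notMem ha]
      calc (B a ∪ ⋃ n ∈ s, B n).ncard ≤ (B a).ncard + (⋃ n ∈ s, B n).ncard := Set.ncard_union_le _ _
        _ ≤ k * k + s.card * (k * k) := add_le_add (hBle a) ih
        _ = (s.card + 1) * (k * k) := by ring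
  calc (chartShadow (E₁ ×ˢ E₂) (fun p : α × β => x₁ p.1 * x₂ p.2) (fun p : α × β => u₁ p.1 + u₂ p.2)
          (fun p : α × β => v₁ p.1 + v₂ p.2)).ncard
      ≤ (⋃ n ∈ Finset.range (K + 1), B n).ncard := Set.ncard_le_ncard hcover hUfin
    _ ≤ (Finset.range (K + 1)).card * (k * k) := hUnion _
    _ = k * k * (k * (chartShadow E₁ x₁ u₁ v₁).ncard + k * (chartShadow E₂ x₂ u₂ v₂).ncard + 1) := by
        rw [Finset.card_range, hK, hU₁card, hU₂card]; ring

/-- **The product bound for configuration shadows.** -/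
theorem ncard_cshadow_prod_le (X₁ Y₁ : α → ℝ) (X₂ Y₂ : β → ℝ) :
    (cshadow (E₁ ×ˢ E₂) (fun p : α × β => x₁ p.1 * x₂ p.2) (fun p : α × β => X₁ p.1 + X₂ p.2)
        (fun p : α × β => Y₁ p.1 + Y₂ p.2)).ncard ≤
      2 * (k * k * (k * (cshadow E₁ x₁ X₁ Y₁).ncard + k * (cshadow E₂ x₂ X₂ Y₂).ncard + 1)) + k + k + 1 := by
  have h := ncard_cshadow_le_charts (E₁ ×ˢ E₂) (fun p : α × β => x₁ p.1 * x₂ p.2)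
    (fun p : α × β => X₁ p.1 + X₂ p.2) (fun p : α × β => Y₁ p.1 + Y₂ p.2)
  have hpos := ncard_chartShadow_prod_le E₁ E₂ x₁ x₂ X₁ Y₁ X₂ Y₂
  have hneg' := ncard_chartShadow_prod_le E₁ E₂ x₁ x₂ (fun e => -X₁ e) Y₁ (fun e => -X₂ e) Y₂
  have hfun : (fun p : α × β => -(X₁ p.1 + X₂ p.2)) = fun p : α × β => -X₁ p.1 + -X₂ p.2 := by
    funext p; ring
  rw [hfun] at h
  have s₁ := Set.ncard_le_ncard (chartShadow_pos_subset E₁ x₁ X₁ Y₁) (cshadow_finite _ _ _ _)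
  have s₁' := Set.ncard_le_ncard (chartShadow_neg_subset E₁ x₁ X₁ Y₁) (cshadow_finite _ _ _ _)
  have s₂ := Set.ncard_le_ncard (chartShadow_pos_subset E₂ x₂ X₂ Y₂) (cshadow_finite _ _ _ _)
  have s₂' := Set.ncard_le_ncard (chartShadow_neg_subset E₂ x₂ X₂ Y₂) (cshadow_finite _ _ _ _)
  have b₁ : k * k * (k * (chartShadow E₁ x₁ X₁ Y₁).ncard + k * (chartShadow E₂ x₂ X₂ Y₂).ncard + 1) ≤
      k * k * (k * (cshadow E₁ x₁ X₁ Y₁).ncard + k * (cshadow E₂ x₂ X₂ Y₂).ncard + 1) := by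
    gcongr
  have b₂ : k * k * (k * (chartShadow E₁ x₁ (fun e => -X₁ e) Y₁).ncard +
      k * (chartShadow E₂ x₂ (fun e => -X₂ e) Y₂).ncard + 1) ≤
      k * k * (k * (cshadow E₁ x₁ X₁ Y₁).ncard + k * (cshadow E₂ x₂ X₂ Y₂).ncard + 1) := by
    gcongr
  omega

end Product

end

end QuasiPoly

/-- **The product bound, definition-free export.**  For the product configuration on `E₁ ×ˢ E₂` (Hadamard-product
vectors, added planar coordinates) the number of words that are lex-greedy for SOME injective planar direction is at most
`2k²(k s₁ + k s₂ + 1) + 2k + 1`, where `sᵢ` is the same count for the factor `Eᵢ`. -/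
theorem configShadow_prod_le (α β : Type) (k : ℕ) (E₁ : Finset α) (E₂ : Finset β) (x₁ : α → Fin k → ℂ)
    (x₂ : β → Fin k → ℂ) (X₁ Y₁ : α → ℝ) (X₂ Y₂ : β → ℝ) :
    {p : α × β | ∃ w : Fin 2 → ℝ,
        Set.InjOn (fun p : α × β => w 0 * (X₁ p.1 + X₂ p.2) + w 1 * (Y₁ p.1 + Y₂ p.2)) (E₁ ×ˢ E₂ : Finset (α × β)) ∧
        p ∈ {p : α × β | p ∈ E₁ ×ˢ E₂ ∧ x₁ p.1 * x₂ p.2 ∉ Submodule.span ℂ ((fun p : α × β => x₁ p.1 * x₂ p.2) ''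
          {p' : α × β | p' ∈ E₁ ×ˢ E₂ ∧ w 0 * (X₁ p.1 + X₂ p.2) + w 1 * (Y₁ p.1 + Y₂ p.2) <
            w 0 * (X₁ p'.1 + X₂ p'.2) + w 1 * (Y₁ p'.1 + Y₂ p'.2)})}}.ncard ≤
      2 * (k * k * (k * {e : α | ∃ w : Fin 2 → ℝ, Set.InjOn (fun e => w 0 * X₁ e + w 1 * Y₁ e) E₁ ∧
          e ∈ {e : α | e ∈ E₁ ∧ x₁ e ∉ Submodule.span ℂ (x₁ '' {e' : α | e' ∈ E₁ ∧
            w 0 * X₁ e + w 1 * Y₁ e < w 0 * X₁ e' + w 1 * Y₁ e'})}}.ncard +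
        k * {e : β | ∃ w : Fin 2 → ℝ, Set.InjOn (fun e => w 0 * X₂ e + w 1 * Y₂ e) E₂ ∧
          e ∈ {e : β | e ∈ E₂ ∧ x₂ e ∉ Submodule.span ℂ (x₂ '' {e' : β | e' ∈ E₂ ∧
            w 0 * X₂ e + w 1 * Y₂ e < w 0 * X₂ e' + w 1 * Y₂ e'})}}.ncard + 1)) + k + k + 1 :=
  QuasiPoly.ncard_cshadow_prod_le E₁ E₂ x₁ x₂ X₁ Y₁ X₂ Y₂

end Summit.ValiantsHypothesis.ValiantsHypothesis.Theorems.NewtonUnitEquationsDissociatedUniform
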